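import Summits.HubbardSuperconductivity.HubbardLadder.Links
import HarnessLib

/-!
# Rungs R3/R4 — the pair-field density as the average of the per-displacement correlators, and the
R4⁻ certificate from a uniform bound on the SUMMED correlator

HONEST FRAMING (page 1): ladder R1–R4 with certified numbers; no claim on H/H₀. This file proves
EDGES only (no certificate exists today). The links "certificate shape ⇒ typed target" are in the
tree (`Links.lean`); here: the exact identity tying the R3 observable `avgPairCorr L r` (one
displacement) to the R4 order parameter `pairFieldDensity L` — `p_d(L) = L⁻² Σ_{r ∈ Λ_L} P̄_d(L, r)`
(R4-MEMO item M1) — and the R4⁻ certificate obtained from a uniform bound on the summed correlator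
(what an `ℓ¹` decay envelope in torus distance, uniform in `L`, supplies), linked to the cell target
`NoDWaveOrderPureU8Eighth` through `Links.noDWaveOrderPureU8Eighth_of_vanishingCeilingCert`; plus the
name `R3DichotomyU8Eighth L r` of the R3 object at the headline pair of models.

Contents: `sum_avgPairCorr_succ`, `pairFieldDensity_succ_eq_sum_avgPairCorr` (identity) ·
`SummedPairCorrCeilingCert` (uniform `Σ_r P̄_d(L, r) ≤ S`) and `.toVanishing :
VanishingPairFieldCeilingCert` (`u L = S / L²`) · `noDWaveOrderPureU8Eighth_of_summedCeilingCert` ·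
`R3DichotomyU8Eighth`.
-/

namespace Summit.HubbardSuperconductivity.HubbardLadder

open Matrix Finset Filter Literature.Probability.LatticeModels
  Literature.MathematicalPhysics.QuantumLattice
open scoped ComplexOrder Topology

noncomputable section

/-! ## §1 `p_d(L) = L⁻² Σ_r P̄_d(L, r)` -/

/-- Translation reindexing on the torus: `Σ_s f(x + s) = Σ_y f(y)`. [folklore] -/
theorem sum_add_left_torus {M : Type*} [AddCommMonoid M] {L : ℕ} [NeZero L]
    (x : TorusSite 2 L) (f : TorusSite 2 L → M) :
    ∑ s : TorusSite 2 L, f (x + s) = ∑ y : TorusSite 2 L, f y :=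
  Fintype.sum_equiv (Equiv.addLeft x) _ _ fun _ => rfl

/-- Unfolding `avgPairCorr` at positive side. [folklore] -/
theorem avgPairCorr_succ (L : ℕ) (r : Site 2) (ψ : Fock (Orb (FermionTorus 2 (L + 1)))) :
    avgPairCorr (L + 1) r ψ =
      (∑ x : TorusSite 2 (L + 1),
          (expect ((localPair dWaveFormFactor (L + 1) x)ᴴ *
              localPair dWaveFormFactor (L + 1) (x + Torus.proj (L + 1) r)) ψ).re) /
        ((L + 1 : ℕ) : ℝ) ^ 2 := rfl

/-- Unfolding `pairFieldDensity` at positive side. [folklore] -/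
theorem pairFieldDensity_succ (L : ℕ) (ψ : Fock (Orb (FermionTorus 2 (L + 1)))) :
    pairFieldDensity (L + 1) ψ =
      (expect ((pairField dWaveFormFactor (L + 1))ᴴ * pairField dWaveFormFactor (L + 1)) ψ).re /
        ((L + 1 : ℕ) : ℝ) ^ 4 := rfl

/-- The summed translation-averaged correlator over the fundamental domain is the full double sum:
`Σ_{r ∈ [0,L)²} P̄_d(L, r; ψ) · L² = Σ_{x,y} re ⟨ψ, P_x† P_y ψ⟩`, i.e.
`Σ_r P̄_d(L+1, r) = (L+1)² · p_d(L+1)`. [cite: Scalapino1995, §2 eq. (2.4)] -/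
theorem sum_avgPairCorr_succ (L : ℕ) (ψ : Fock (Orb (FermionTorus 2 (L + 1)))) :
    ∑ r ∈ halfOpenBox 2 (L + 1), avgPairCorr (L + 1) r ψ =
      ((L + 1 : ℕ) : ℝ) ^ 2 * pairFieldDensity (L + 1) ψ := by
  have hL : ((L + 1 : ℕ) : ℝ) ≠ 0 := by positivity
  calc ∑ r ∈ halfOpenBox 2 (L + 1), avgPairCorr (L + 1) r ψ
      = (∑ r ∈ halfOpenBox 2 (L + 1), ∑ x : TorusSite 2 (L + 1),
          (expect ((localPair dWaveFormFactor (L + 1) x)ᴴ *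
              localPair dWaveFormFactor (L + 1) (x + Torus.proj (L + 1) r)) ψ).re) /
          ((L + 1 : ℕ) : ℝ) ^ 2 := by
        rw [Finset.sum_div]
        exact Finset.sum_congr rfl fun r _ => avgPairCorr_succ L r ψ
    _ = (∑ s : TorusSite 2 (L + 1), ∑ x : TorusSite 2 (L + 1),
          (expect ((localPair dWaveFormFactor (L + 1) x)ᴴ *
              localPair dWaveFormFactor (L + 1) (x + s)) ψ).re) / ((L + 1 : ℕ) : ℝ) ^ 2 := by
        rw [sum_halfOpenBox_torusProj (L + 1) (fun s => ∑ x : TorusSite 2 (L + 1),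
          (expect ((localPair dWaveFormFactor (L + 1) x)ᴴ *
              localPair dWaveFormFactor (L + 1) (x + s)) ψ).re)]
    _ = (∑ x : TorusSite 2 (L + 1), ∑ y : TorusSite 2 (L + 1),
          (expect ((localPair dWaveFormFactor (L + 1) x)ᴴ *
              localPair dWaveFormFactor (L + 1) y) ψ).re) / ((L + 1 : ℕ) : ℝ) ^ 2 := by
        rw [Finset.sum_comm]
        exact congrArg (· / ((L + 1 : ℕ) : ℝ) ^ 2)
          (Finset.sum_congr rfl fun x _ => sum_add_left_torus x (fun y =>
            (expect ((localPair dWaveFormFactor (L + 1) x)ᴴ *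
              localPair dWaveFormFactor (L + 1) y) ψ).re))
    _ = (expect ((pairField dWaveFormFactor (L + 1))ᴴ * pairField dWaveFormFactor (L + 1)) ψ).re /
          ((L + 1 : ℕ) : ℝ) ^ 2 := by
        rw [expect_pairField_conjTranspose_mul_holds dWaveFormFactor (L + 1) ψ, Complex.re_sum]
        simp_rw [Complex.re_sum]
    _ = ((L + 1 : ℕ) : ℝ) ^ 2 * pairFieldDensity (L + 1) ψ := by
        rw [pairFieldDensity_succ]
        field_simp

/-- **The pair-field density is the average of the per-displacement correlators**:
`p_d(L+1; ψ) = (L+1)⁻² Σ_{r ∈ [0,L+1)²} P̄_d(L+1, r; ψ)`. [cite: Scalapino1995, §2 eq. (2.4)] -/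
theorem pairFieldDensity_succ_eq_sum_avgPairCorr (L : ℕ) (ψ : Fock (Orb (FermionTorus 2 (L + 1)))) :
    pairFieldDensity (L + 1) ψ =
      (∑ r ∈ halfOpenBox 2 (L + 1), avgPairCorr (L + 1) r ψ) / ((L + 1 : ℕ) : ℝ) ^ 2 := by
  rw [sum_avgPairCorr_succ, mul_div_cancel_left₀ _ (by positivity)]

/-! ## §2 R4⁻ from a uniform bound on the summed correlator -/

/-- **R4⁻ certificate shape, summed-correlator form.** A number `S` with
`Σ_{r ∈ [0,L)²} P̄_d(L, r; ψ) ≤ S` for every normalised sector ground state `ψ` on every even side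
`L ≥ L₀` — what a translation-invariant relaxation UPPER envelope `P̄_d(L, r) ≤ F(dist(0,r))` with
`F ∈ ℓ¹(ℤ²)`, valid uniformly in `L` (its constraints live in windows of diameter `< L`), supplies with
`S = ‖F‖₁`. [cite: QinEtAl2020, §III.B] -/
structure SummedPairCorrCeilingCert (H : TorusHamiltonianFamily) (N : ℕ → ℕ) where
  /-- the uniform bound on the summed correlator -/
  S : ℝ
  /-- the side from which it holds -/
  L₀ : ℕ
  bound : ∀ L, L₀ ≤ L → Even L → ∀ ψ : Fock (Orb (FermionTorus 2 L)), star ψ ⬝ᵥ ψ = 1 →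
    IsGroundStateInSector (H L) (N L) 0 ψ → ∑ r ∈ halfOpenBox 2 L, avgPairCorr L r ψ ≤ S

/-- **R4⁻ chain, summed form (proved).** A uniform bound `S` on the summed correlator is a vanishing
ceiling certificate with `u L = S / L²`; hence (tree, `R3R4Props`) the order parameter of every
admissible ground-state sequence tends to `0` and no sequence has pair-field LRO. [folklore] -/
def SummedPairCorrCeilingCert.toVanishing {H : TorusHamiltonianFamily} {N : ℕ → ℕ}
    (c : SummedPairCorrCeilingCert H N) : VanishingPairFieldCeilingCert H N where
  u L := c.S / (L : ℝ) ^ 2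
  L₀ := c.L₀
  tendsto_zero :=
    tendsto_const_nhds.div_atTop
      ((tendsto_pow_atTop two_ne_zero).comp tendsto_natCast_atTop_atTop)
  bound L hL hE ψ h₁ h₂ := by
    cases L with
    | zero => simp [pairFieldDensity]
    | succ L =>
      rw [pairFieldDensity_succ_eq_sum_avgPairCorr]
      exact div_le_div_of_nonneg_right (c.bound (L + 1) hL hE ψ h₁ h₂) (by positivity)

/-! ## §3 Link to the typed target and the R3 object at the headline models -/

/-- The same edge from the summed-correlator certificate. [cite: QinEtAl2020, §IV p. 11] -/
theorem noDWaveOrderPureU8Eighth_of_summedCeilingCert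
    (cert : SummedPairCorrCeilingCert (pureHubbard 8) (electronNumber (1 / 8))) :
    NoDWaveOrderPureU8Eighth :=
  noDWaveOrderPureU8Eighth_of_vanishingCeilingCert cert.toVanishing

/-- **R3 at the headline pair of models** — the finite dichotomy object the cell's R3 rows
instantiate: `Hneg = pureHubbard 8`, `Hpos L = hubbardTorusTT' L 1 (-1/4) 8`, `N = electronNumber (1/8)`.
A term of this type at `(L, r)` is exactly the result line "certified: at L, r,
P_d^{t'=0}(r) ≤ a < b ≤ P_d^{t'=-1/4}(r)". [cite: QinEtAl2020, §III.B] [cite: XuEtAl2024, §II] -/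
abbrev R3DichotomyU8Eighth (L : ℕ) (r : Site 2) : Type :=
  FiniteDichotomyCert (pureHubbard 8) (fun L => hubbardTorusTT' L 1 (-1 / 4) 8)
    (electronNumber (1 / 8)) L r

end

end Summit.HubbardSuperconductivity.HubbardLadder
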